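import Summits.HodgeConjecture.HodgeConjecture.Theorems.PadicSemiregularLiftHodgeFermatVarietiesGeneralTwinSplit

/-!
# GP without the twin exclusion, II — (L-twin) even, or a full fibre, at two primes (`even_or_fibre_twoPrime`)

Part 2 of 9 (Sketch Part C, ll. 245–553): **`even_or_fibre_twoPrime`** — let `p ≠ r` be primes `≥ 5`, `n > 1` coprime to `p r` with prime factors `≥ 5`, and
`T : ℤ/(p r n) → ℂ` `{0,1}`-valued, vanishing off the units, annihilated by every odd character mod `p r n`, with `#supp T + 1 < p'` for every prime `p' ∣ n` and
`#supp T ≤ r - 1`. Then `T` is even, or for some unit `b` mod `n` and some unit `u₀` mod `p` the whole `r`-fibre `{crt⁻¹(a, b) : a ≡ u₀ (mod p)}` lies in `supp T`,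
or for some unit `b` mod `n` and unit `y₀` mod `r` the whole `p`-fibre lies in `supp T` (twin use: `r = p + 2`, `#supp T = p + 1`). Two `local notation3`
(`πq[p']`, `Reg[P, x, z]`, verbatim from the line's c2/c4 files).

PROVENANCE. Cell hodge-nonav (HUMAN RULING D-0038), planner seat p1 g33: chapter ROUTE-P1AF addenda ADD4 ∕ ADD5 (memos `HOME/memos/ROUTE-P1AF-ADD4.md`
b7ad80a65555c84d, `…-ADD5.md` ffaf9911041dfeba; referee PASS 0∕0: ref g52 REF-P1AF-ADD4.md 83f6fe06da4ed38e, ref g53 REF-P1AF-ADD5.md bcccb0bceb665800),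
frozen Sketch `HOME/p1/route/Sketch_P1AF_RGENTWIN_g33.lean` (sha16 596f05bb769cab0c, 1805 lines, namespaces `HodgeNonAV.P1AF.GenTwin` + the line's
`…CancelByAnyClaimLattice.PairedNull ∕ .CoprimeSix`, farm rc 0 / 0 sorries / axioms {propext, Classical.choice, Quot.sound}; re-elaborated 2026-08-28), split into
nine tree modules `…GeneralTwinSplit` → `…GeneralTwinLocal` → `…GeneralTwinLevel` → `…GeneralTwinLevelOne` → `…GeneralTwinGlue` → `…FibreOfTopLevelGeneralTwinKey` → `…FibreOfTopLevelGeneralTwin` →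
`…FibreOfProgressionGeneralTwin` → `…GeneralTwinPayoff` by planner p1 g34 (landing kit HOME/p1/landing/); proof bodies verbatim (cell namespace renamed
`…Theorems.CancelByAnyClaimLattice.GenTwin`); docstrings reworded per referee rider N-ADD4-1 (Aoki 1983 cites are METHOD attributions; the statements without
the twin exclusion are not in print). Target: lead c4's `CoprimeSix.hodgeConjectureFor_general` (`Theorems/…GeneralPayoff`) WITHOUT the hypothesis
`htwin : ¬ p₁ (p₁+2) ∣ m` — replaced by `(p₁+2)² ∤ m`. Land with `--supports stmt-HodgeConjecture-1334` (line `cancel-by-any-claim-lattice` of crux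
`HodgeFermatVarieties`, route `PadicSemiregularLift`). No instance, no new notation (the `local notation3` of Parts 2, 3 and 9 are the line's, verbatim from
`Theorems/PadicSemiregularLiftHodgeFermatVarietiesFibreOfBoundaryPow` ∕ `…GeneralPayoff`), no sorry, no new axiom.
HONEST SCOPE: the HC pay-off `hodgeConjectureFor_general₂` is MODULO the line's named facts (S0) and stub statements (S2↑, S2↓, S3a, S5), exactly as c4's
`hodgeConjectureFor_general`; Fermat varieties are dominated by abelian motives (inside the known AV region); NOTHING here proves the Hodge conjecture.
References (method): N. Aoki, Math. Ann. 266 (1983) Thm A′ (§7), Prop. 2.2, Prop. 6.4, §9 [cite: Aoki1983, Thm. A]; N. Aoki, J. Math. Soc. Japan 39 (1987)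
Thm 1-1, Thm 2-1 [cite: Aoki1987, Thm. 2-1]; T. Shioda, Proc. Japan Acad. 55 (1979) §2 Thm 1 [cite: Shioda1979PJA, Thm. 1].
-/

set_option linter.dupNamespace false

noncomputable section

namespace Summit.HodgeConjecture.HodgeConjecture.Theorems.CancelByAnyClaimLattice.GenTwin

open Finset
open Literature.AlgebraicGeometry.HodgeTheory Literature.AlgebraicGeometry.HodgeTheory.FermatCharacter
open Summit.HodgeConjecture.HodgeConjecture.Theorems.CancelByAnyClaimLattice
open Summit.HodgeConjecture.HodgeConjecture.Theorems.CancelByAnyClaimLattice.PairedNull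
open Summit.HodgeConjecture.HodgeConjecture.Theorems.CancelByAnyClaimLattice.FiveQ.FourierSplit

section Main

variable {p r n : ℕ} [Fact p.Prime] [Fact r.Prime] [NeZero n]

/-- `πq[p']` — reduction from level `p · r · n` to the prime power `p' ^ v_{p'}(n)` of `n`. Local notation (c2/c4). -/
local notation3 (prettyPrint := false) "πq[" p' "]" =>
  ZMod.castHom ((Nat.ordProj_dvd n p').trans (dvd_mul_left n (p * r))) (ZMod (p' ^ n.factorization p'))

/-- `Reg[P, x, z]` — `z ≡ ±x` modulo `p' ^ v_{p'}(n)` for every `p' ∈ P`. Local notation (c2/c4). -/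
local notation3 (prettyPrint := false) "Reg[" P ", " x ", " z "]" =>
  ∀ p' ∈ (P : Finset ℕ), πq[p'] z = πq[p'] x ∨ πq[p'] z = -(πq[p'] x)

/-- **(L-twin) Even, or a full fibre, at two primes.** Let `p ≠ r` be primes `≥ 5`, `n > 1` coprime to `p r` with all
prime factors `≥ 5`, and `T : ℤ/(p r n) → ℂ` `{0,1}`-valued, vanishing off the units, annihilated by every odd primitive
character mod `p r n`, with `#supp T + 1 < p'` for every prime `p' ∣ n` and `#supp T ≤ r - 1`. Then `T` is even, or for
some unit `b` mod `n` and some unit `u₀` mod `p` the whole `r`-fibre `{crt⁻¹(a, b) : a unit, a ≡ u₀ (mod p)}` lies in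
`supp T`, or for some unit `b` mod `n` and some unit `y₀` mod `r` the whole `p`-fibre `{crt⁻¹(a, b) : a unit,
a ≡ y₀ (mod r)}` lies in `supp T`. (Twin-prime use: `r = p + 2`, `#supp T = p + 1`.)
(method after [cite: Aoki1983, Prop. 6.4] and Aoki 1983 §9; statement new — cell hodge-nonav P1 g33, memo ROUTE-P1AF-ADD4 — not in print) -/
theorem even_or_fibre_twoPrime (hp5 : 5 ≤ p) (hr5 : 5 ≤ r) (hprc : p.Coprime r) (hn1 : n ≠ 1)
    (hn5 : ∀ p' ∈ n.primeFactors, 5 ≤ p') (hc : (p * r).Coprime n)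
    (T : ZMod (p * r * n) → ℂ) (h01 : ∀ z, T z = 0 ∨ T z = 1) (hTu : ∀ z, ¬ IsUnit z → T z = 0)
    (hT : ∀ χ : DirichletCharacter ℂ (p * r * n), χ.Odd → χ.IsPrimitive →
      ∑ z : ZMod (p * r * n), T z * χ z = 0)
    (hroom : ∀ p' ∈ n.primeFactors, #(univ.filter fun z : ZMod (p * r * n) ↦ T z ≠ 0) + 1 < p')
    (hsuppT : #(univ.filter fun z : ZMod (p * r * n) ↦ T z ≠ 0) ≤ r - 1) :
    (∀ z, T (-z) = T z) ∨
    (∃ b : ZMod n, IsUnit b ∧ ∃ u₀ : (ZMod p)ˣ, ∀ a : ZMod (p * r), IsUnit a →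
        ZMod.castHom (dvd_mul_right p r) (ZMod p) a = u₀ → T ((ZMod.chineseRemainder hc).symm (a, b)) ≠ 0) ∨
    (∃ b : ZMod n, IsUnit b ∧ ∃ y₀ : (ZMod r)ˣ, ∀ a : ZMod (p * r), IsUnit a →
        ZMod.castHom (dvd_mul_left r p) (ZMod r) a = y₀ → T ((ZMod.chineseRemainder hc).symm (a, b)) ≠ 0) := by
  classical
  have hp : p.Prime := Fact.out
  have hr : r.Prime := Fact.out
  have hn0 : n ≠ 0 := NeZero.ne n
  have hq₀odd : Odd (p * r) := (hp.odd_of_ne_two (by omega)).mul (hr.odd_of_ne_two (by omega))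
  have hq₀5 : 5 ≤ p * r := le_trans hp5 (Nat.le_mul_of_pos_right p hr.pos)
  have hnodd : Odd n := by
    rw [Nat.odd_iff]
    by_contra h2
    have h2n : 2 ∣ n := Nat.dvd_of_mod_eq_zero (by omega)
    have := hn5 2 (Nat.mem_primeFactors.mpr ⟨Nat.prime_two, h2n, hn0⟩)
    omega
  by_cases hev : ∀ z, T (-z) = T z
  · exact Or.inl hev
  push Not at hev
  obtain ⟨z₀, hz₀⟩ := hev
  have hz₀u : IsUnit z₀ := by
    by_contra hnu
    exact hz₀ (by rw [hTu z₀ hnu, hTu (-z₀) (fun h ↦ hnu (by simpa using h.neg))])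
  -- the piece of `T` around `z₀`
  set Tp : ZMod (p * r * n) → ℂ := fun z ↦ if Reg[n.primeFactors, z₀, z] then T z else 0 with hTp
  have hTpann := piece_annihilated_odd hq₀odd hq₀5 hc hn5 T hTu hT hroom hz₀u n.primeFactors (subset_refl _)
  have hTpsupp : ∀ z, Tp z ≠ 0 → IsUnit z ∧ Reg[n.primeFactors, z₀, z] := by
    intro z hz
    by_cases hreg : Reg[n.primeFactors, z₀, z]
    · refine ⟨?_, hreg⟩
      by_contra hnu
      exact hz (by simp only [hTp, if_pos hreg, hTu z hnu])
    · exact absurd (by simp only [hTp, if_neg hreg]) hz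
  have hTpval : ∀ z, Tp z ≠ 0 → Tp z = T z := by
    intro z hz
    by_cases hreg : Reg[n.primeFactors, z₀, z]
    · simp only [hTp, if_pos hreg]
    · exact absurd (by simp only [hTp, if_neg hreg]) hz
  have hTp01 : ∀ z, Tp z = 0 ∨ Tp z = 1 := by
    intro z
    by_cases hreg : Reg[n.primeFactors, z₀, z]
    · simp only [hTp, if_pos hreg]; exact h01 z
    · exact Or.inl (by simp only [hTp, if_neg hreg])
  have hTpreg : ∀ z, Reg[n.primeFactors, z₀, z] → Tp z = T z := fun z hreg ↦ by simp only [hTp, if_pos hreg]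
  have hregz₀ : Reg[n.primeFactors, z₀, z₀] := fun p' _ ↦ Or.inl rfl
  have hregnz₀ : Reg[n.primeFactors, z₀, -z₀] := fun p' _ ↦ Or.inr (by rw [map_neg])
  -- coordinates of `z₀`
  set a₀ : ZMod (p * r) := ZMod.castHom (dvd_mul_right (p * r) n) (ZMod (p * r)) z₀ with ha₀
  set b₀ : ZMod n := ZMod.castHom (dvd_mul_left n (p * r)) (ZMod n) z₀ with hb₀
  have ha₀u : IsUnit a₀ := hz₀u.map _
  have hb₀u : IsUnit b₀ := hz₀u.map _
  have hz₀eq : (ZMod.chineseRemainder hc).symm (a₀, b₀) = z₀ := crt_symm_castHom hc z₀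
  have hb₀ne : b₀ ≠ -b₀ := by
    intro h
    have h2 : (2 : ZMod n) = 0 := by
      have h2b : (2 : ZMod n) * b₀ = 0 := by linear_combination (1 : ZMod n) * h
      have := congrArg (· * (hb₀u.unit⁻¹ : (ZMod n)ˣ).val) h2b
      simpa only [mul_assoc, IsUnit.mul_val_inv, mul_one, zero_mul] using this
    have hdvd : n ∣ 2 := (ZMod.natCast_eq_zero_iff 2 n).mp (by exact_mod_cast h2)
    have hle := Nat.le_of_dvd (by norm_num) hdvd
    obtain ⟨k, hk⟩ := hnodd
    omega
  -- the fibre-difference function on `ℤ/(p r)`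
  set E : ZMod (p * r) → ℂ := fun a ↦ Tp ((ZMod.chineseRemainder hc).symm (a, b₀)) -
    Tp (-(ZMod.chineseRemainder hc).symm (a, b₀)) with hE
  have hEorth : ∀ χ₁ : DirichletCharacter ℂ (p * r), χ₁.IsPrimitive →
      ∑ a : ZMod (p * r), E a * χ₁ a = 0 := fun χ₁ hχ₁ ↦
    piece_fibreDiff_orthogonal hc hn5 Tp hTpann hz₀u hTpsupp b₀ χ₁ hχ₁
  have hEorth' : ∀ (ψ₁ : DirichletCharacter ℂ p) (ψ₂ : DirichletCharacter ℂ r), ψ₁ ≠ 1 → ψ₂ ≠ 1 →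
      ∑ a : ZMod (p * r), E a * (DirichletCharacter.changeLevel (dvd_mul_right p r) ψ₁ *
        DirichletCharacter.changeLevel (dvd_mul_left r p) ψ₂) a = 0 := fun ψ₁ ψ₂ h₁ h₂ ↦
    hEorth _ (prodChar_isPrimitive hprc (FiveQ.isPrimitive_of_ne_one h₁) (FiveQ.isPrimitive_of_ne_one h₂))
  obtain ⟨G, H, hGH⟩ := split_of_orthogonal_all p r hprc E hEorth'
  -- values of `E`
  have hE01 : ∀ a, E a = 0 ∨ E a = 1 ∨ E a = -1 := by
    intro a
    simp only [hE]
    rcases hTp01 ((ZMod.chineseRemainder hc).symm (a, b₀)) with h | h <;>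
      rcases hTp01 (-(ZMod.chineseRemainder hc).symm (a, b₀)) with h' | h' <;>
      simp only [h, h'] <;> norm_num
  have hpos : ∀ a, E a = 1 → T ((ZMod.chineseRemainder hc).symm (a, b₀)) ≠ 0 := by
    intro a ha
    have h1 : Tp ((ZMod.chineseRemainder hc).symm (a, b₀)) ≠ 0 := by
      intro h0
      simp only [hE, h0, zero_sub] at ha
      rcases hTp01 (-(ZMod.chineseRemainder hc).symm (a, b₀)) with h' | h' <;> rw [h'] at ha <;> norm_num at ha
    rwa [hTpval _ h1] at h1
  have hneg : ∀ a, E a = -1 → T ((ZMod.chineseRemainder hc).symm (-a, -b₀)) ≠ 0 := by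
    intro a ha
    have h1 : Tp (-(ZMod.chineseRemainder hc).symm (a, b₀)) ≠ 0 := by
      intro h0
      simp only [hE, h0, sub_zero] at ha
      rcases hTp01 ((ZMod.chineseRemainder hc).symm (a, b₀)) with h' | h' <;> rw [h'] at ha <;> norm_num at ha
    rw [hTpval _ h1, ← crt_symm_neg] at h1
    exact h1
  have hEa₀ : E a₀ ≠ 0 := by
    simp only [hE]
    rw [hz₀eq, hTpreg _ hregz₀, hTpreg _ hregnz₀]
    exact sub_ne_zero.mpr (Ne.symm hz₀)
  -- `#supp E ≤ #supp T ≤ r - 1`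
  have hsuppE : #(univ.filter fun a : ZMod (p * r) ↦ E a ≠ 0) ≤ r - 1 := by
    refine le_trans ?_ hsuppT
    refine Finset.card_le_card_of_injOn
      (fun a ↦ if Tp ((ZMod.chineseRemainder hc).symm (a, b₀)) ≠ 0 then (ZMod.chineseRemainder hc).symm (a, b₀)
        else -(ZMod.chineseRemainder hc).symm (a, b₀)) ?_ ?_
    · intro a ha
      simp only [Finset.coe_filter, Finset.mem_univ, true_and, Set.mem_setOf_eq] at ha ⊢
      by_cases h1 : Tp ((ZMod.chineseRemainder hc).symm (a, b₀)) ≠ 0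
      · rw [if_pos h1, ← hTpval _ h1]; exact h1
      · rw [if_neg h1]
        have h2 : Tp (-(ZMod.chineseRemainder hc).symm (a, b₀)) ≠ 0 := by
          intro h2; apply ha; simp only [hE, not_not.mp h1, h2, sub_zero]
        rw [← hTpval _ h2]; exact h2
    · intro a₁ h₁ a₂ h₂ h12
      simp only at h12
      have hn₁ := (castHom_crt_symm hc a₁ b₀).2
      have hn₂ := (castHom_crt_symm hc a₂ b₀).2
      split_ifs at h12
      · exact (Prod.mk.inj ((ZMod.chineseRemainder hc).symm.injective h12)).1
      · exfalso; apply hb₀ne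
        have := congrArg (ZMod.castHom (dvd_mul_left n (p * r)) (ZMod n)) h12
        rw [map_neg, hn₁, hn₂] at this; exact this
      · exfalso; apply hb₀ne
        have := congrArg (ZMod.castHom (dvd_mul_left n (p * r)) (ZMod n)) h12
        rw [map_neg, hn₁, hn₂] at this
        exact this.symm
      · exact (Prod.mk.inj ((ZMod.chineseRemainder hc).symm.injective (neg_inj.mp h12))).1
  -- CRT coordinates at the two primes
  choose ℓ hℓ₁ hℓ₂ using fun (u : (ZMod p)ˣ) (y : (ZMod r)ˣ) ↦ exists_unit_crt hprc u y
  have hcoordp : ∀ u y, ZMod.castHom (dvd_mul_right p r) (ZMod p) ((ℓ u y : (ZMod (p * r))ˣ) : ZMod (p * r)) = u := by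
    intro u y
    have := congrArg Units.val (hℓ₁ u y)
    simpa [ZMod.unitsMap_def] using this
  have hcoordr : ∀ u y, ZMod.castHom (dvd_mul_left r p) (ZMod r) ((ℓ u y : (ZMod (p * r))ˣ) : ZMod (p * r)) = y := by
    intro u y
    have := congrArg Units.val (hℓ₂ u y)
    simpa [ZMod.unitsMap_def] using this
  have hinj : ∀ a a' : ZMod (p * r), ZMod.castHom (dvd_mul_right p r) (ZMod p) a = ZMod.castHom (dvd_mul_right p r) (ZMod p) a' →
      ZMod.castHom (dvd_mul_left r p) (ZMod r) a = ZMod.castHom (dvd_mul_left r p) (ZMod r) a' → a = a' := by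
    intro a a' h1 h2
    rw [← crt_symm_castHom hprc a, ← crt_symm_castHom hprc a', h1, h2]
  -- every unit with `p`-coordinate `u` is some `ℓ u y`, and dually
  have hliftp : ∀ (u : (ZMod p)ˣ) (a : ZMod (p * r)), IsUnit a →
      ZMod.castHom (dvd_mul_right p r) (ZMod p) a = u → ∃ y, a = ℓ u y := by
    intro u a ha hpa
    refine ⟨ZMod.unitsMap (dvd_mul_left r p) ha.unit, hinj _ _ (by rw [hcoordp, hpa]) ?_⟩
    rw [hcoordr]
    simp [ZMod.unitsMap_def]
  have hliftr : ∀ (y : (ZMod r)ˣ) (a : ZMod (p * r)), IsUnit a →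
      ZMod.castHom (dvd_mul_left r p) (ZMod r) a = y → ∃ u, a = ℓ u y := by
    intro y a ha hra
    refine ⟨ZMod.unitsMap (dvd_mul_right p r) ha.unit, hinj _ _ ?_ (by rw [hcoordr, hra])⟩
    rw [hcoordp]
    simp [ZMod.unitsMap_def]
  -- the grid form of `E`
  have hM : ∀ u y, E (ℓ u y) = G y + H u := fun u y ↦ by rw [hGH, hℓ₁, hℓ₂]
  -- ROW conclusion from a constant non-zero row, COLUMN conclusion from a constant non-zero column
  have rowOf : ∀ (u : (ZMod p)ˣ) (c : ℂ), c ≠ 0 → (∀ y, E (ℓ u y) = c) →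
      (∃ b : ZMod n, IsUnit b ∧ ∃ u₀ : (ZMod p)ˣ, ∀ a : ZMod (p * r), IsUnit a →
        ZMod.castHom (dvd_mul_right p r) (ZMod p) a = u₀ → T ((ZMod.chineseRemainder hc).symm (a, b)) ≠ 0) := by
    intro u c hc0 hrow
    have hc1 : c = 1 ∨ c = -1 := by
      rcases hE01 (ℓ u 1) with h | h | h
      · exact absurd (by rw [← hrow 1, h]) hc0
      · exact Or.inl (by rw [← hrow 1, h])
      · exact Or.inr (by rw [← hrow 1, h])
    rcases hc1 with rfl | rfl
    · refine ⟨b₀, hb₀u, u, fun a ha hpa ↦ hpos a ?_⟩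
      obtain ⟨y, rfl⟩ := hliftp u a ha hpa
      exact hrow y
    · refine ⟨-b₀, hb₀u.neg, -u, fun a ha hpa ↦ ?_⟩
      have hna : ZMod.castHom (dvd_mul_right p r) (ZMod p) (-a) = u := by
        rw [map_neg, hpa, Units.val_neg, neg_neg]
      obtain ⟨y, hy⟩ := hliftp u (-a) ha.neg hna
      have := hneg (-a) (by rw [hy]; exact hrow y)
      rwa [neg_neg] at this
  have colOf : ∀ (y : (ZMod r)ˣ) (c : ℂ), c ≠ 0 → (∀ u, E (ℓ u y) = c) →
      (∃ b : ZMod n, IsUnit b ∧ ∃ y₀ : (ZMod r)ˣ, ∀ a : ZMod (p * r), IsUnit a →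
        ZMod.castHom (dvd_mul_left r p) (ZMod r) a = y₀ → T ((ZMod.chineseRemainder hc).symm (a, b)) ≠ 0) := by
    intro y c hc0 hcol
    have hc1 : c = 1 ∨ c = -1 := by
      rcases hE01 (ℓ 1 y) with h | h | h
      · exact absurd (by rw [← hcol 1, h]) hc0
      · exact Or.inl (by rw [← hcol 1, h])
      · exact Or.inr (by rw [← hcol 1, h])
    rcases hc1 with rfl | rfl
    · refine ⟨b₀, hb₀u, y, fun a ha hra ↦ hpos a ?_⟩
      obtain ⟨u, rfl⟩ := hliftr y a ha hra
      exact hcol u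
    · refine ⟨-b₀, hb₀u.neg, -y, fun a ha hra ↦ ?_⟩
      have hna : ZMod.castHom (dvd_mul_left r p) (ZMod r) (-a) = y := by
        rw [map_neg, hra, Units.val_neg, neg_neg]
      obtain ⟨u, hu⟩ := hliftr y (-a) ha.neg hna
      have := hneg (-a) (by rw [hu]; exact hcol u)
      rwa [neg_neg] at this
  right
  by_cases hH : ∃ u₁ u₂, H u₁ ≠ H u₂
  · -- ROW CASE: `H` not constant
    left
    obtain ⟨u₁, u₂, hne⟩ := hH
    have hrow : ∀ y, E (ℓ u₁ y) ≠ 0 ∨ E (ℓ u₂ y) ≠ 0 := by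
      intro y
      by_contra h0
      push Not at h0
      apply hne
      have e1 := hM u₁ y
      have e2 := hM u₂ y
      rw [h0.1] at e1
      rw [h0.2] at e2
      linear_combination e2 - e1
    set SE := univ.filter fun a : ZMod (p * r) ↦ E a ≠ 0 with hSE
    set w : (ZMod r)ˣ → ZMod (p * r) := fun y ↦ if E (ℓ u₁ y) ≠ 0 then (ℓ u₁ y : ZMod (p * r)) else ℓ u₂ y with hw
    have hwmem : ∀ y, w y ∈ SE := by
      intro y
      simp only [hSE, Finset.mem_filter, Finset.mem_univ, true_and, hw]
      by_cases h1 : E (ℓ u₁ y) ≠ 0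
      · rw [if_pos h1]; exact h1
      · rw [if_neg h1]; exact (hrow y).resolve_left h1
    have hwp : ∀ y, ZMod.castHom (dvd_mul_right p r) (ZMod p) (w y) = u₁ ∨
        ZMod.castHom (dvd_mul_right p r) (ZMod p) (w y) = u₂ := by
      intro y
      simp only [hw]
      by_cases h1 : E (ℓ u₁ y) ≠ 0
      · rw [if_pos h1, hcoordp]; exact Or.inl rfl
      · rw [if_neg h1, hcoordp]; exact Or.inr rfl
    have hwr : ∀ y, ZMod.castHom (dvd_mul_left r p) (ZMod r) (w y) = y := by
      intro y
      simp only [hw]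
      by_cases h1 : E (ℓ u₁ y) ≠ 0
      · rw [if_pos h1, hcoordr]
      · rw [if_neg h1, hcoordr]
    have hwinj : Function.Injective w := fun y y' h ↦ Units.ext (by rw [← hwr y, ← hwr y', h])
    have himg : univ.image w = SE := by
      apply Finset.eq_of_subset_of_card_le
      · intro x hx
        obtain ⟨y, -, rfl⟩ := Finset.mem_image.mp hx
        exact hwmem y
      · rw [Finset.card_image_of_injective _ hwinj, Finset.card_univ, ZMod.card_units_eq_totient,
          Nat.totient_prime hr]
        exact hsuppE
    -- a third row is empty, so `G` is constant
    have hcard3 : 2 < Fintype.card (ZMod p)ˣ := by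
      rw [ZMod.card_units_eq_totient, Nat.totient_prime hp]; omega
    obtain ⟨u₃, hu₃⟩ : ∃ u₃ : (ZMod p)ˣ, u₃ ∉ ({u₁, u₂} : Finset (ZMod p)ˣ) := by
      by_contra hall
      push Not at hall
      have hsub : (univ : Finset (ZMod p)ˣ) ⊆ {u₁, u₂} := fun u _ ↦ hall u
      have := (Finset.card_le_card hsub).trans Finset.card_le_two
      rw [Finset.card_univ] at this
      omega
    have hu₃₁ : u₃ ≠ u₁ := fun h ↦ hu₃ (by rw [h]; exact Finset.mem_insert_self _ _)
    have hu₃₂ : u₃ ≠ u₂ := fun h ↦ hu₃ (by rw [h]; exact Finset.mem_insert_of_mem (Finset.mem_singleton_self _))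
    have hrow₃ : ∀ y, E (ℓ u₃ y) = 0 := by
      intro y
      by_contra hne0
      have hmem : ((ℓ u₃ y : (ZMod (p * r))ˣ) : ZMod (p * r)) ∈ SE := by
        simp only [hSE, Finset.mem_filter, Finset.mem_univ, true_and]; exact hne0
      rw [← himg] at hmem
      obtain ⟨y', -, hy'⟩ := Finset.mem_image.mp hmem
      have hp' := hwp y'
      rw [hy', hcoordp] at hp'
      rcases hp' with h | h
      · exact hu₃₁ (Units.ext h)
      · exact hu₃₂ (Units.ext h)
    have hGc : ∀ y, G y = -H u₃ := fun y ↦ by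
      have := hM u₃ y; rw [hrow₃ y] at this; linear_combination -this
    have hsplit : H u₁ - H u₃ ≠ 0 ∨ H u₂ - H u₃ ≠ 0 := by
      by_contra h0
      push Not at h0
      exact hne (by linear_combination h0.1 - h0.2)
    rcases hsplit with h | h
    · exact rowOf u₁ _ h (fun y ↦ by rw [hM, hGc]; ring)
    · exact rowOf u₂ _ h (fun y ↦ by rw [hM, hGc]; ring)
  · -- COLUMN CASE: `H` constant
    right
    push Not at hH
    obtain ⟨y₁, ha₀eq⟩ := hliftp (ZMod.unitsMap (dvd_mul_right p r) ha₀u.unit) a₀ ha₀u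
      (by simp [ZMod.unitsMap_def])
    set u₁ := ZMod.unitsMap (dvd_mul_right p r) ha₀u.unit with hu₁
    refine colOf y₁ (E a₀) hEa₀ (fun u ↦ ?_)
    rw [ha₀eq, hM, hM, hH u u₁]

end Main

end Summit.HodgeConjecture.HodgeConjecture.Theorems.CancelByAnyClaimLattice.GenTwin

end
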